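/-
Copyright (c) 2026 the pub-hodgecm-mathlib formalisation cell (harness21).  Prover seat hodgecm-mathlib-K2Liu-p09 (g5): Track B «K2-LIT»,
hLiu418 = stmt-HodgeConjecture-24832; LEAD F0P6-plan RULINGS M-156m∕o, M-157a (4)∕c∕m «A7 = GK COCYCLE ROAD», file B7-V.
-/
import Summits.HodgeConjecture.HodgeConjecture.Theorems.K2LiuSiegelCocycleStageLong             -- ★ B7-A (components of `σ`, modulus; + B4d-1b)
import Summits.HodgeConjecture.HodgeConjecture.Theorems.K2LiuSiegelCocycleStageShort            -- ★ B7-B (`ms_w`, `val_placeUnit`)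
import HarnessLib

/-!
# Crux `HLiu418`, road `K2_Liu`, organ A7-reg (GK cocycle road), file B7-V:
# THE TORUS CHARACTERS OF THE COCYCLE ON THE RANK-ONE UNITS — the `(C₀, ν, e)` data of the short-root step and of the last long-root step

Cell `hodgecm-mathlib`, crux item hLiu418 = `stmt-HodgeConjecture-24832`; squad K2 ∕ K2Liu; prover K2Liu-p09 (g5).  THEOREMS ONLY (no `def`, no instance,
no notation, no named-fact hypothesis, no `sorry`); lane `--supports stmt-HodgeConjecture-24832` (count-neutral helper).  ONE FRAME (RULING M-156o (c)).
THE POINT.  Along `M_v(s) = A₂ A₁ A₂` the torus law of the running function is `θ(a,b) = χ_s(φ t(a,b))` (★ B4d-1b), then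
`θ_𝒜(a,b) = χ_s(φ t(a, σ(b)⁻¹)) · ∏_w ‖b_w‖` (★ B7-A `stageLong_apply_torusElt`), then its `w`-swaps (★ B7-B `stageShort_apply_torusElt`).  The `hrel` binder of
★ `K2LiuRankOneOperators.integrable_and_integral_eq` wants these laws EVALUATED at the rank-one units as `C₀ · ν(x)⁻¹ · |x|^{−e}`.  Here:
* §1 atoms: `χ_s(φ t(ms_w(y), 1)) = χ_w(y) ‖y‖_w^{s+1}`, `χ_s(φ t(σ(ms_w(y)), 1)) = χ_{cw}(c_w y) ‖y‖_w^{s+1}` (★ B1b-2c (L2), ★ B7-A `prod_comp_conjLocal`,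
  ★ `norm_galAdicCompletionMap`), `∏_{w′} ‖ms_w(y)_{w′}‖ = ‖y‖_w`, the `w₁`-swap is trivial on `w₂`-supported units.
* §2 **the short-root datum**: `θ_𝒜(ms_w(−x⁻¹), ms_w(x)) = χ_w(−1) · (χ_w · χ_{cw}∘c_w)(x)⁻¹ · |x|_w^{−(2s+1)}` — `(C₀, ν, e) = (χ_w(−1), chiNorm_w, 2s+1)`, the
  `L_{E_w}(2s, χ_F∘N)` step (★ T1 `chiNorm`). [cite: HarrisKudlaSweet1996, §6 (6.16)]
* §3 **the last long-root datum**: `χ_s(φ t(−X⁻¹, 1)) · ∏_w ‖X_w‖ = [χ_s(φ t(−δ⁻¹,1)) ∏_w ‖δ_w‖] · χ_{F,v}(x)⁻¹ · |x|_v^{−2s}` for `X = ι_v(x)δ` — `(C₀, ν, e) =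
  (χ_s(φ t(−δ⁻¹,1)) ∏_w‖δ_w‖, χ_{F,v}, 2s)`, the `L_F(2s−1, χ_F)` step.
HONEST LABEL.  `HC_CM` is proved only modulo the 7 printed citations (2 remaining named inputs: hLiu418 = `stmt-HodgeConjecture-24832`,
h413 = `stmt-HodgeConjecture-24833`) until rung 0 closes.

## References
* [HarrisKudlaSweet1996] M. Harris, S. Kudla, W. J. Sweet, J. AMS 9 (1996), §1 (1.15), §6 (6.14)–(6.16) (the three `L`-factors of the cocycle).
* [Casselman1980] W. Casselman, *The unramified principal series of p-adic groups I*, Compositio Math. 40 (1980), §3.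
* [CasselsFrohlichANT1967] J. W. S. Cassels, A. Fröhlich (eds.), *Algebraic Number Theory* (1967), Ch. II §11, Ch. VII §1.1.
-/

set_option autoImplicit false
set_option linter.dupNamespace false -- the mandated namespace repeats `HodgeConjecture.HodgeConjecture`

noncomputable section

open scoped Classical NNReal
open NumberField IsDedekindDomain Matrix
open Literature.NumberTheory.GaloisRepresentations.IsNonarchimedeanLocalField
open Literature.NumberTheory.Automorphic Literature.NumberTheory.Automorphic.UnitaryGroup
open Literature.NumberTheory.GelbartRogawski1991.AdaptedBlocks
open Literature.NumberTheory.GelbartRogawski1991.UnitaryDualPair.LocalSplitting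
open Literature.NumberTheory.K2Lit.LocalSiegelDoubled
open Summit.HodgeConjecture.HodgeConjecture.Cruxes.HLiu418.K2LiuLocalLFactorDefs
open Summit.HodgeConjecture.HodgeConjecture.Cruxes.HLiu418.K2LiuLocalSiegelIwasawaFrame
open Summit.HodgeConjecture.HodgeConjecture.Cruxes.HLiu418.K2LiuLocalSiegelIwasawa
open Summit.HodgeConjecture.HodgeConjecture.Cruxes.HLiu418.K2LiuGKRankOneIdentityLFactor
open Summit.HodgeConjecture.HodgeConjecture.Cruxes.HLiu418.K2LiuDoubledUTwoTwoBorelFrame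
open Summit.HodgeConjecture.HodgeConjecture.Cruxes.HLiu418.K2LiuDoubledUTwoTwoFrameTransport
open Summit.HodgeConjecture.HodgeConjecture.Cruxes.HLiu418.K2LiuDoubledUTwoTwoLeviTransport
open Summit.HodgeConjecture.HodgeConjecture.Cruxes.HLiu418.K2LiuSiegelCocycleLetters
open Summit.HodgeConjecture.HodgeConjecture.Cruxes.HLiu418.K2LiuSiegelCocycleStageLong
open Summit.HodgeConjecture.HodgeConjecture.Cruxes.HLiu418.K2LiuSiegelCocycleStageShort

namespace Summit.HodgeConjecture.HodgeConjecture.Cruxes.HLiu418.K2LiuSiegelCocycleValues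

variable (F : Type) [Field F] [NumberField F] (E : Type) [Field E] [NumberField E] [Algebra F E]
  [Algebra.IsQuadraticExtension F E] (c : E ≃ₐ[F] E)
  {δ : E} (hcδ : c δ = -δ) (hδ : δ ≠ 0) {d : F} (hd : δ * δ = algebraMap F E d) (v : HeightOneSpectrum (𝓞 F))
  {T₂ : Matrix (Fin 2) (Fin 2) F} (hT₂ : T₂.IsSymm) {J₂D : Matrix (Fin (2 + 2)) (Fin (2 + 2)) E} (hJ₂D : J₂D = (gramD F 2 T₂).map (algebraMap F E))
  (D Dinv : Matrix (Fin 2) (Fin 2) F) (hDD : D * Dinv = 1) (Q : GL (Fin (2 + 2)) F)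
  (hQm : (Q : Matrix (Fin (2 + 2)) (Fin (2 + 2)) F) = Matrix.reindex (e₂ 2) (e₂ 2) (Matrix.fromBlocks 1 D 1 (-D)))
  (hQ : (Q : Matrix (Fin (2 + 2)) (Fin (2 + 2)) F)ᵀ * gramD F 2 T₂ * (Q : Matrix (Fin (2 + 2)) (Fin (2 + 2)) F) = (StdForm.antidiagonal (2 + 2)).over F)
  (w : PlacesOver E v)

/-! ## §1 Atoms: components of the units supported at `w`, of their `σ`-conjugates, and the torus character on them -/

section Atoms

omit [NumberField F] [Algebra.IsQuadraticExtension F E] in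
/-- `ms_w(y)_w = y`. [cite: CasselsFrohlichANT1967, Ch. II §11] -/
theorem eval_placeUnit_same (y : (w.1.adicCompletion E)ˣ) :
    Units.map (Pi.evalMonoidHom (fun w' : PlacesOver E v => w'.1.adicCompletion E) w)
        (Units.map (MonoidHom.mulSingle (fun w' : PlacesOver E v => w'.1.adicCompletion E) w) y) = y :=
  Units.ext (by simp)

omit [NumberField F] [Algebra.IsQuadraticExtension F E] in
/-- `ms_w(y)_{w′} = 1` for `w′ ≠ w`. [cite: CasselsFrohlichANT1967, Ch. II §11] -/
theorem eval_placeUnit_of_ne {w' : PlacesOver E v} (h : w' ≠ w) (y : (w.1.adicCompletion E)ˣ) :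
    Units.map (Pi.evalMonoidHom (fun w' : PlacesOver E v => w'.1.adicCompletion E) w')
        (Units.map (MonoidHom.mulSingle (fun w' : PlacesOver E v => w'.1.adicCompletion E) w) y) = 1 :=
  Units.ext (by simp [Pi.mulSingle_eq_of_ne h])

omit [NumberField F] [Algebra.IsQuadraticExtension F E] in
/-- **the `w₁`-projection kills `w₂`-supported units**: `ms_{w₁}(ms_{w₂}(y)_{w₁}) = 1` (`w₁ ≠ w₂`) — the second short-root stage sees the first one's swap
trivially. [cite: HarrisKudlaSweet1996, §6 (6.16)] -/
theorem placeUnit_eval_placeUnit_of_ne {w₁ w₂ : PlacesOver E v} (h : w₁ ≠ w₂) (y : (w₂.1.adicCompletion E)ˣ) :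
    Units.map (MonoidHom.mulSingle (fun w' : PlacesOver E v => w'.1.adicCompletion E) w₁)
        (Units.map (Pi.evalMonoidHom (fun w' : PlacesOver E v => w'.1.adicCompletion E) w₁)
          (Units.map (MonoidHom.mulSingle (fun w' : PlacesOver E v => w'.1.adicCompletion E) w₂) y)) = 1 := by
  rw [eval_placeUnit_of_ne F E v w₂ h, map_one]

omit [Algebra.IsQuadraticExtension F E] in
/-- **units-level components of `σ`**: `(σ u)_{cw} = c_w(u_w)`. [cite: CasselsFrohlichANT1967, Ch. VII §1.1] -/
theorem eval_galPlace_conjLocal (u : (UnitaryGroup.LocalRing E v)ˣ) (w₀ : PlacesOver E v) :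
    Units.map (Pi.evalMonoidHom (fun w' : PlacesOver E v => w'.1.adicCompletion E) (galPlace c w₀))
        (Units.map (UnitaryGroup.conjLocal E c v : UnitaryGroup.LocalRing E v →* UnitaryGroup.LocalRing E v) u) =
      Units.map ((galAdicCompletionMap (L := E) c (rfl : c • w₀.1 = (galPlace c w₀).1)).toMonoidHom :
          w₀.1.adicCompletion E →* (galPlace c w₀).1.adicCompletion E)
        (Units.map (Pi.evalMonoidHom (fun w' : PlacesOver E v => w'.1.adicCompletion E) w₀) u) :=
  Units.ext (conjLocal_apply_of_smul_eq F E c v (u : UnitaryGroup.LocalRing E v) w₀ (galPlace c w₀) rfl)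

omit [Algebra.IsQuadraticExtension F E] in
/-- **reindexing the character product along `w ↦ cw`**: `∏_{w′} χ_{w′}((σu)_{w′}) = ∏_{w₀} χ_{cw₀}(c_{w₀}(u_{w₀}))`.
[cite: CasselsFrohlichANT1967, Ch. VII §1.1] -/
theorem prod_chi_conjLocal (χv : ∀ w' : PlacesOver E v, (w'.1.adicCompletion E)ˣ →* ℂˣ) (u : (UnitaryGroup.LocalRing E v)ˣ) :
    ∏ w' : PlacesOver E v, ((χv w' (Units.map (Pi.evalMonoidHom (fun w' : PlacesOver E v => w'.1.adicCompletion E) w')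
        (Units.map (UnitaryGroup.conjLocal E c v : UnitaryGroup.LocalRing E v →* UnitaryGroup.LocalRing E v) u)) : ℂˣ) : ℂ) =
      ∏ w₀ : PlacesOver E v, ((χv (galPlace c w₀) (Units.map ((galAdicCompletionMap (L := E) c (rfl : c • w₀.1 = (galPlace c w₀).1)).toMonoidHom :
          w₀.1.adicCompletion E →* (galPlace c w₀).1.adicCompletion E)
        (Units.map (Pi.evalMonoidHom (fun w' : PlacesOver E v => w'.1.adicCompletion E) w₀) u)) : ℂˣ) : ℂ) := by
  refine (Fintype.prod_equiv ⟨galPlace c, galPlace c⁻¹, fun w => Subtype.ext (inv_smul_smul c w.1), fun w => Subtype.ext (smul_inv_smul c w.1)⟩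
    _ _ fun w₀ => ?_).symm
  exact (congrArg (fun u' => ((χv (galPlace c w₀) u' : ℂˣ) : ℂ)) (eval_galPlace_conjLocal F E c v u w₀)).symm

omit [Algebra.IsQuadraticExtension F E] in
/-- `∏_{w′} ‖ms_w(y)_{w′}‖ = ‖y‖_w`. [cite: CasselsFrohlichANT1967, Ch. II §11] -/
theorem prod_norm_placeUnit (y : (w.1.adicCompletion E)ˣ) :
    ∏ w' : PlacesOver E v, ‖((Units.map (MonoidHom.mulSingle (fun w' : PlacesOver E v => w'.1.adicCompletion E) w) y : (UnitaryGroup.LocalRing E v)ˣ) :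
      UnitaryGroup.LocalRing E v) w'‖ = ‖(y : w.1.adicCompletion E)‖ := by
  rw [Fintype.prod_eq_single w fun w' hw' => by rw [val_placeUnit, Pi.mulSingle_eq_of_ne hw', norm_one]]
  rw [val_placeUnit, Pi.mulSingle_eq_same]

variable (χv : ∀ w : PlacesOver E v, (w.1.adicCompletion E)ˣ →* ℂˣ) (s : ℂ)

include hJ₂D hDD hQm in
/-- **`χ_s(φ t(ms_w(y), 1)) = χ_w(y) · ‖y‖_w^{s+1}`**. [cite: HarrisKudlaSweet1996, §1 (1.15), §6 (6.16)] -/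
theorem localSiegelCharacter_frameConj_torusElt_placeUnit (y : (w.1.adicCompletion E)ˣ) :
    localSiegelCharacter F E c v 2 χv s (FrameTransport.frameConj F E c v (2 + 2) hJ₂D (antidiagonal_over_eq_map F E 2) Q hQ (toLocalFour F E c v
        (torusElt (UnitaryGroup.LocalRing E v) (UnitaryGroup.conjLocal E c v) (UnitaryGroup.conjLocal_conjLocal c v hcδ hδ)
          (Units.map (MonoidHom.mulSingle (fun w' : PlacesOver E v => w'.1.adicCompletion E) w) y) 1))) =
      ((χv w y : ℂˣ) : ℂ) * ((‖(y : w.1.adicCompletion E)‖ : ℝ) : ℂ) ^ (s + 1) := by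
  have hN : ∏ w' : PlacesOver E v, ‖((Units.map (MonoidHom.mulSingle (fun w' : PlacesOver E v => w'.1.adicCompletion E) w) y : (UnitaryGroup.LocalRing E v)ˣ) :
      UnitaryGroup.LocalRing E v) w' * ((1 : (UnitaryGroup.LocalRing E v)ˣ) : UnitaryGroup.LocalRing E v) w'‖ = ‖(y : w.1.adicCompletion E)‖ := by
    rw [← prod_norm_placeUnit F E v w y]
    exact Finset.prod_congr rfl fun w' _ => by rw [Units.val_one, Pi.one_apply, mul_one]
  rw [localSiegelCharacter_frameConj_torusElt F E c hcδ hδ v hJ₂D D Dinv hDD Q hQm hQ χv s, mul_one,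
    Fintype.prod_eq_single w fun w' hw' => by rw [eval_placeUnit_of_ne F E v w hw', map_one, Units.val_one], eval_placeUnit_same, hN]

include hJ₂D hDD hQm in
/-- **`χ_s(φ t(σ(ms_w(y)), 1)) = χ_{cw}(c_w y) · ‖y‖_w^{s+1}`** (the conjugate place carries the second factor of `χ_F ∘ N_{E_w/F_v}`, ★ T1 `chiNorm`).
[cite: HarrisKudlaSweet1996, §6 (6.16)] [cite: CasselsFrohlichANT1967, Ch. VII §1.1] -/
theorem localSiegelCharacter_frameConj_torusElt_conjLocal_placeUnit (y : (w.1.adicCompletion E)ˣ) :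
    localSiegelCharacter F E c v 2 χv s (FrameTransport.frameConj F E c v (2 + 2) hJ₂D (antidiagonal_over_eq_map F E 2) Q hQ (toLocalFour F E c v
        (torusElt (UnitaryGroup.LocalRing E v) (UnitaryGroup.conjLocal E c v) (UnitaryGroup.conjLocal_conjLocal c v hcδ hδ)
          (Units.map (UnitaryGroup.conjLocal E c v : UnitaryGroup.LocalRing E v →* UnitaryGroup.LocalRing E v)
            (Units.map (MonoidHom.mulSingle (fun w' : PlacesOver E v => w'.1.adicCompletion E) w) y)) 1))) =
      ((χv (galPlace c w) (Units.map ((galAdicCompletionMap (L := E) c (rfl : c • w.1 = (galPlace c w).1)).toMonoidHom :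
          w.1.adicCompletion E →* (galPlace c w).1.adicCompletion E) y) : ℂˣ) : ℂ) * ((‖(y : w.1.adicCompletion E)‖ : ℝ) : ℂ) ^ (s + 1) := by
  have hN : ∏ w' : PlacesOver E v, ‖((Units.map (UnitaryGroup.conjLocal E c v : UnitaryGroup.LocalRing E v →* UnitaryGroup.LocalRing E v)
      (Units.map (MonoidHom.mulSingle (fun w' : PlacesOver E v => w'.1.adicCompletion E) w) y) : (UnitaryGroup.LocalRing E v)ˣ) : UnitaryGroup.LocalRing E v) w' *
        ((1 : (UnitaryGroup.LocalRing E v)ˣ) : UnitaryGroup.LocalRing E v) w'‖ = ‖(y : w.1.adicCompletion E)‖ := by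
    rw [← prod_norm_placeUnit F E v w y, ← prod_norm_conjLocal F E c v
      ((Units.map (MonoidHom.mulSingle (fun w' : PlacesOver E v => w'.1.adicCompletion E) w) y : (UnitaryGroup.LocalRing E v)ˣ) : UnitaryGroup.LocalRing E v)]
    exact Finset.prod_congr rfl fun w' _ => by rw [Units.val_one, Pi.one_apply, mul_one]; rfl
  rw [localSiegelCharacter_frameConj_torusElt F E c hcδ hδ v hJ₂D D Dinv hDD Q hQm hQ χv s, mul_one, prod_chi_conjLocal F E c v χv,
    Fintype.prod_eq_single w fun w' hw' => by
      rw [eval_placeUnit_of_ne F E v w hw', map_one]; exact (congrArg Units.val (map_one (χv (galPlace c w')))).trans Units.val_one,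
    eval_placeUnit_same, hN]

end Atoms

/-! ## §2 The short-root datum `(C₀, ν, e) = (χ_w(−1), chiNorm_w, 2s + 1)` -/

section Short

variable (χv : ∀ w : PlacesOver E v, (w.1.adicCompletion E)ˣ →* ℂˣ) (s : ℂ)

/-- `(r⁻¹)^{s+1} (r⁻¹)^{s+1} r = r^{−(2s+1)}` for `r > 0`. [folklore] -/
theorem inv_cpow_mul_inv_cpow_mul {r : ℝ} (hr : 0 < r) (s : ℂ) :
    (((r⁻¹ : ℝ) : ℂ) ^ (s + 1)) * (((r⁻¹ : ℝ) : ℂ) ^ (s + 1)) * (r : ℂ) = ((r : ℝ) : ℂ) ^ (-(2 * s + 1)) := by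
  have hr0 : ((r : ℝ) : ℂ) ≠ 0 := Complex.ofReal_ne_zero.2 hr.ne'
  have harg : ((r : ℝ) : ℂ).arg ≠ Real.pi := by rw [Complex.arg_ofReal_of_nonneg hr.le]; exact Real.pi_pos.ne
  rw [Complex.ofReal_inv, Complex.inv_cpow _ _ harg, ← Complex.cpow_neg, show (-(2 * s + 1) : ℂ) = -(s + 1) + -(s + 1) + 1 by ring,
    Complex.cpow_add _ _ hr0, Complex.cpow_add _ _ hr0, Complex.cpow_one]

include hd hT₂ hJ₂D hDD hQm in
/-- **THE SHORT-ROOT `hrel` DATUM.**  With `θ_𝒜(a,b) = χ_s(φ t(a, σ(b)⁻¹)) · ∏_{w′} ‖b_{w′}‖` (★ B7-A) and `x ∈ E_wˣ`: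
`θ_𝒜(ms_w(−x⁻¹), ms_w(x)) = χ_w(−1) · chiNorm_w(x)⁻¹ · |x|_w^{−(2s+1)}` — the constant `C₀ = χ_w(−1)`, the unitary character `ν = χ_w · (χ_{cw} ∘ c_w)` (★ T1
`chiNorm`) and the exponent `e = 2s + 1` of the middle step: numerator `L_{E_w}(e − 1, ν) = L_{E_w}(2s, χ_F ∘ N)`. [cite: HarrisKudlaSweet1996, §6 (6.16)] [cite: Casselman1980, §3] -/
theorem thetaA_placeUnit (x : (w.1.adicCompletion E)ˣ) :
    localSiegelCharacter F E c v 2 χv s (FrameTransport.frameConj F E c v (2 + 2) hJ₂D (antidiagonal_over_eq_map F E 2) Q hQ (toLocalFour F E c v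
        (torusElt (UnitaryGroup.LocalRing E v) (UnitaryGroup.conjLocal E c v) (UnitaryGroup.conjLocal_conjLocal c v hcδ hδ)
          (Units.map (MonoidHom.mulSingle (fun w' : PlacesOver E v => w'.1.adicCompletion E) w) (-x⁻¹))
          (Units.map (UnitaryGroup.conjLocal E c v : UnitaryGroup.LocalRing E v →* UnitaryGroup.LocalRing E v)
            (Units.map (MonoidHom.mulSingle (fun w' : PlacesOver E v => w'.1.adicCompletion E) w) x)⁻¹)))) *
        ((∏ w' : PlacesOver E v, ‖((Units.map (MonoidHom.mulSingle (fun w' : PlacesOver E v => w'.1.adicCompletion E) w) x : (UnitaryGroup.LocalRing E v)ˣ) :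
          UnitaryGroup.LocalRing E v) w'‖ : ℝ) : ℂ) =
      ((χv w (-1) : ℂˣ) : ℂ) * (((chiNorm F E c v χv w x)⁻¹ : ℂˣ) : ℂ) *
        ((normAbs (w.1.adicCompletion E) (x : w.1.adicCompletion E) : ℝ) : ℂ) ^ (-(2 * s + 1)) := by
  have hx0 : (0 : ℝ) < ‖(x : w.1.adicCompletion E)‖ := norm_pos_iff.2 x.ne_zero
  have hr0 : ((‖(x : w.1.adicCompletion E)‖ : ℝ) : ℂ) ≠ 0 := Complex.ofReal_ne_zero.2 hx0.ne'
  have harg : ((‖(x : w.1.adicCompletion E)‖ : ℝ) : ℂ).arg ≠ Real.pi := by rw [Complex.arg_ofReal_of_nonneg hx0.le]; exact Real.pi_pos.ne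
  have hP : ((‖(x : w.1.adicCompletion E)‖ : ℝ) : ℂ) ^ (s + 1) ≠ 0 := by
    rw [Complex.cpow_def_of_ne_zero hr0]; exact Complex.exp_ne_zero _
  have hχ0 : ((χv w x : ℂˣ) : ℂ) ≠ 0 := (χv w x).ne_zero
  have hχ1 : ((χv (galPlace c w) (Units.map ((galAdicCompletionMap (L := E) c (rfl : c • w.1 = (galPlace c w).1)).toMonoidHom :
      w.1.adicCompletion E →* (galPlace c w).1.adicCompletion E) x) : ℂˣ) : ℂ) ≠ 0 := Units.ne_zero _
  have hn1 : ‖((-x⁻¹ : (w.1.adicCompletion E)ˣ) : w.1.adicCompletion E)‖ = ‖(x : w.1.adicCompletion E)‖⁻¹ := by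
    rw [Units.val_neg, norm_neg, Units.val_inv_eq_inv_val, norm_inv]
  have hχneg : ((χv w (-x⁻¹) : ℂˣ) : ℂ) = ((χv w (-1) : ℂˣ) : ℂ) * (((χv w x) : ℂˣ) : ℂ)⁻¹ := by
    rw [← neg_one_mul, map_mul, map_inv, Units.val_mul, Units.val_inv_eq_inv_val]
  have hfold : (((chiNorm F E c v χv w x)⁻¹ : ℂˣ) : ℂ) = ((((χv w x) : ℂˣ) : ℂ) *
      ((χv (galPlace c w) (Units.map ((galAdicCompletionMap (L := E) c (rfl : c • w.1 = (galPlace c w).1)).toMonoidHom :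
        w.1.adicCompletion E →* (galPlace c w).1.adicCompletion E) x) : ℂˣ) : ℂ))⁻¹ := by
    rw [Units.val_inv_eq_inv_val]; rfl
  rw [localSiegelCharacter_frameConj_torusElt_eq_mul F E c hcδ hδ hd v hT₂ hJ₂D D Dinv hDD Q hQm hQ χv s, map_inv,
    localSiegelCharacter_frameConj_torusElt_inv F E c hcδ hδ hd v hT₂ hJ₂D D Dinv hDD Q hQm hQ χv s,
    localSiegelCharacter_frameConj_torusElt_placeUnit F E c hcδ hδ v hJ₂D D Dinv hDD Q hQm hQ w χv s,
    localSiegelCharacter_frameConj_torusElt_conjLocal_placeUnit F E c hcδ hδ v hJ₂D D Dinv hDD Q hQm hQ w χv s, prod_norm_placeUnit, hfold, hχneg, hn1,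
    ← norm_eq_coe_normAbs E w.1, ← inv_cpow_mul_inv_cpow_mul hx0 s, Complex.ofReal_inv, Complex.inv_cpow _ _ harg]
  field_simp

end Short

/-! ## §3 The last long-root datum `(C₀, ν, e) = (χ_s(φ t(−δ⁻¹,1)) ∏_w ‖δ_w‖, χ_{F,v}, 2s)` -/

section Long

variable (χv : ∀ w : PlacesOver E v, (w.1.adicCompletion E)ˣ →* ℂˣ) (s : ℂ)

omit [Algebra.IsQuadraticExtension F E] in
/-- `∏_w ‖(−u⁻¹)_w‖ = (∏_w ‖u_w‖)⁻¹`. [cite: CasselsFrohlichANT1967, Ch. II §11] -/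
theorem prod_norm_neg_inv (u : (UnitaryGroup.LocalRing E v)ˣ) :
    ∏ w' : PlacesOver E v, ‖((-u⁻¹ : (UnitaryGroup.LocalRing E v)ˣ) : UnitaryGroup.LocalRing E v) w'‖ =
      (∏ w' : PlacesOver E v, ‖(u : UnitaryGroup.LocalRing E v) w'‖)⁻¹ := by
  rw [← Finset.prod_inv_distrib]
  refine Finset.prod_congr rfl fun w' _ => ?_
  have h : ((u⁻¹ : (UnitaryGroup.LocalRing E v)ˣ) : UnitaryGroup.LocalRing E v) w' = ((u : UnitaryGroup.LocalRing E v) w')⁻¹ :=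
    eq_inv_of_mul_eq_one_right (by rw [← Pi.mul_apply, Units.mul_inv, Pi.one_apply])
  rw [Units.val_neg, Pi.neg_apply, norm_neg, h, norm_inv]

/-- `∏_w ‖X_w‖ = |x|_v² ∏_w ‖δ_w‖` for the coordinate unit `X = ι_v(x)δ`. [cite: CasselsFrohlichANT1967, Ch. II §11] -/
theorem prod_norm_coordUnit (x : (v.adicCompletion F)ˣ) :
    ∏ w' : PlacesOver E v, ‖((Units.map (UnitaryGroup.toLocalRing E v : v.adicCompletion F →* UnitaryGroup.LocalRing E v) x *
        (Units.mk0 δ hδ).map (algebraMap E (UnitaryGroup.LocalRing E v) : E →* UnitaryGroup.LocalRing E v) : (UnitaryGroup.LocalRing E v)ˣ) :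
        UnitaryGroup.LocalRing E v) w'‖ =
      ‖(x : v.adicCompletion F)‖ ^ 2 * ∏ w' : PlacesOver E v, ‖algebraMap E (UnitaryGroup.LocalRing E v) δ w'‖ := by
  rw [← prod_norm_toPlace_eq_sq F E v, ← Finset.prod_mul_distrib]
  exact Finset.prod_congr rfl fun w' _ => by rw [val_coordUnit, Pi.mul_apply, norm_mul, toLocalRing_apply]

/-- `r^{−(2s+2)} · r² = r^{−2s}` for `r > 0`. [folklore] -/
theorem cpow_neg_two_mul_add_two_mul_sq {r : ℝ} (hr : 0 < r) (s : ℂ) :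
    ((r : ℝ) : ℂ) ^ (-(2 * s + 2)) * ((r ^ 2 : ℝ) : ℂ) = ((r : ℝ) : ℂ) ^ (-(2 * s)) := by
  have hr0 : ((r : ℝ) : ℂ) ≠ 0 := Complex.ofReal_ne_zero.2 hr.ne'
  rw [Complex.ofReal_pow, ← Complex.cpow_natCast, ← Complex.cpow_add _ _ hr0]
  congr 1
  push_cast
  ring

include hd hT₂ hJ₂D hDD hQm in
/-- **THE LAST LONG-ROOT `hrel` DATUM (atom).**  `χ_s(φ t(−X⁻¹, 1)) · ∏_w ‖X_w‖ = [χ_s(φ t(−δ⁻¹, 1)) · ∏_w ‖δ_w‖] · χ_{F,v}(x)⁻¹ · |x|_v^{−2s}` for `X = ι_v(x)δ`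
(`−X⁻¹ = ι_v(x⁻¹)·(−δ⁻¹)`, ★ B4d-1b; `∏_w ‖X_w‖ = |x|_v² ∏_w ‖δ_w‖`): the constant `C₀(s) = χ_s(φ t(−δ⁻¹,1)) ∏_w‖δ_w‖`, `ν = χ_{F,v}`, `e = 2s` of the last step —
numerator `L_F(e − 1, χ_F) = L_F(2s − 1, χ_F)`. [cite: HarrisKudlaSweet1996, §6 (6.16)] [cite: Casselman1980, §3] -/
theorem thetaB_atom (x : (v.adicCompletion F)ˣ) :
    localSiegelCharacter F E c v 2 χv s (FrameTransport.frameConj F E c v (2 + 2) hJ₂D (antidiagonal_over_eq_map F E 2) Q hQ (toLocalFour F E c v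
        (torusElt (UnitaryGroup.LocalRing E v) (UnitaryGroup.conjLocal E c v) (UnitaryGroup.conjLocal_conjLocal c v hcδ hδ)
          (-(Units.map (UnitaryGroup.toLocalRing E v : v.adicCompletion F →* UnitaryGroup.LocalRing E v) x *
            (Units.mk0 δ hδ).map (algebraMap E (UnitaryGroup.LocalRing E v) : E →* UnitaryGroup.LocalRing E v))⁻¹) 1))) *
        ((∏ w' : PlacesOver E v, ‖((Units.map (UnitaryGroup.toLocalRing E v : v.adicCompletion F →* UnitaryGroup.LocalRing E v) x *
          (Units.mk0 δ hδ).map (algebraMap E (UnitaryGroup.LocalRing E v) : E →* UnitaryGroup.LocalRing E v) : (UnitaryGroup.LocalRing E v)ˣ) :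
          UnitaryGroup.LocalRing E v) w'‖ : ℝ) : ℂ) =
      localSiegelCharacter F E c v 2 χv s (FrameTransport.frameConj F E c v (2 + 2) hJ₂D (antidiagonal_over_eq_map F E 2) Q hQ (toLocalFour F E c v
          (torusElt (UnitaryGroup.LocalRing E v) (UnitaryGroup.conjLocal E c v) (UnitaryGroup.conjLocal_conjLocal c v hcδ hδ)
            (-((Units.mk0 δ hδ).map (algebraMap E (UnitaryGroup.LocalRing E v) : E →* UnitaryGroup.LocalRing E v))⁻¹) 1))) *
        ((∏ w' : PlacesOver E v, ‖algebraMap E (UnitaryGroup.LocalRing E v) δ w'‖ : ℝ) : ℂ) *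
        ((((chiF F E v χv x)⁻¹ : ℂˣ) : ℂ) * ((normAbs (v.adicCompletion F) (x : v.adicCompletion F) : ℝ) : ℂ) ^ (-(2 * s))) := by
  have hx0 : (0 : ℝ) < ‖(x : v.adicCompletion F)‖ := norm_pos_iff.2 x.ne_zero
  have hsplit := localSiegelCharacter_frameConj_torusElt_mul F E c hcδ hδ hd v hT₂ hJ₂D D Dinv hDD Q hQm hQ χv s
    (Units.map (UnitaryGroup.toLocalRing E v : v.adicCompletion F →* UnitaryGroup.LocalRing E v) x⁻¹) 1
    (-((Units.mk0 δ hδ).map (algebraMap E (UnitaryGroup.LocalRing E v) : E →* UnitaryGroup.LocalRing E v))⁻¹) 1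
  rw [one_mul] at hsplit
  rw [neg_inv_coordUnit, hsplit, localSiegelCharacter_frameConj_torusElt_coord_inv F E c hcδ hδ v hJ₂D D Dinv hDD Q hQm hQ χv s x, prod_norm_coordUnit,
    Complex.ofReal_mul, norm_eq_coe_normAbs F v, ← cpow_neg_two_mul_add_two_mul_sq (by rw [← norm_eq_coe_normAbs F v]; exact hx0) s]
  ring

end Long

end Summit.HodgeConjecture.HodgeConjecture.Cruxes.HLiu418.K2LiuSiegelCocycleValues

end
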